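import Summits.HodgeConjecture.CorCM.GaloisCyclicFourCompositum
import Summits.HodgeConjecture.CorCM.GaloisQuaternionKleinFour
import HarnessLib

/-!
# Composita `K = M · L`: TWO-FIBRE types — a primitive type of `L` over a balanced aperiodic half of `Gal(M/ℚ)`;
# `Q_{4n}`-CM fields die under every such totally real Galois factor

COR-CM (cell `pub-hodgecm2`), binder seat b04 (gen 23), count-neutral claim CYCLIC-BY-MULTIPLIERS, part XII (blanket
NAME ACK `CorCM/GaloisQuaternion*`, HOME/INBOX l.9747).  HC_CM is NOT proved here; unconditional negative-side
examples.

Setting: `Gal(K/ℚ) ≅ H × Γ` with complex conjugation `(1, c₁)` — `K = M · L`, `M = K^Γ` totally real Galois with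
group `H`, `L = K^H` a Galois CM field with group `Γ` and complex conjugation `c₁`, linearly disjoint.

THE TWO-FIBRE TYPE.  Let `F ⊆ Γ` be a PRIMITIVE CM type of `L` and `A ⊆ H` a HALF of `H` (`2|A| = |H|`) which is
APERIODIC (`aA = A ⟹ a = 1`) and NOWHERE SELF-COMPLEMENTARY (`aA ≠ H ∖ A` for all `a`).  Put the fibre `F` over
every `q ∈ A` and the conjugate fibre `c₁F = Γ ∖ F` over every `q ∉ A`.  Every `v ∈ Γ` then lies in exactly `|A|` or
`|H ∖ A|`, i.e. `|H|/2`, fibres, so by part IX (`exists_simple_degenerate_of_model_fibres`, balanced set `H × {1}`)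
the type is DEGENERATE; it is PRIMITIVE: a period `(a, b)` with `b = 1` forces `aA = A`; with `b = c₁` it forces
`aA = H ∖ A`; any other `b` would stabilise `F` (`bF = F` or `c₁bF = F`), contradicting primitivity of `F`
(`exists_simple_degenerate_of_model_twoFibre`).  For `Γ = C₂` (an imaginary quadratic `L`) this is gen 19's
mechanism, for `Γ = C₄` part X's two-level functions; the point is that `Γ` and `F` are now ARBITRARY.

APPLICATION (`exists_simple_degenerate_of_quaternion_compositum`).  `L` a `Q_{4n}`-CM field (`n ≥ 1`,
`c₁ = aⁿ`; primitive type = the double interval of part VII-b) and `M` any totally real Galois field whose group has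
a balanced aperiodic nowhere-self-complementary half `A` ⟹ `K = M·L` carries a SIMPLE DEGENERATE abelian variety of
dimension `2n|H|`.  Such halves exist in every group of even order `≥ 6` met so far (e.g. `{0,1,3} ⊂ ℤ/6`,
`exists_simple_degenerate_of_quaternion_cyclicSix_compositum`: `Gal ≅ C₆ × Q_{4n}` is BAD), and in none of order
`≤ 4` — consistent with `Q₈ × C₂` GOOD (gen 20) and with `Q₈ × C₂²`, `Q₈ × C₄` needing the arithmetic certificates
of parts VII–IX.

References: Shimura (1998), §6.2 Thm. 3, §8.2 Prop. 26 [cite: Shimura1998]; Gordon (1999), Thm. 6.4, §9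
[cite: Gordon1999HodgeAVSurvey].
-/

noncomputable section

open CategoryTheory CategoryTheory.Limits NumberField
open scoped BigOperators

namespace Summit.HodgeConjecture.CorCM.GaloisModels

open Literature.NumberTheory.ComplexMultiplication
open Literature.AlgebraicGeometry.Motives (AbelianVariety CMType)
open Literature.AlgebraicGeometry.HodgeTheory
open Literature.AlgebraicGeometry.ComplexMultiplication (IsCMTypeRealisation)
open Literature.AlgebraicGeometry.Pohlmann1968
open Literature.Barriers.HodgeConjecture (divisorClassesSpan)

section TwoFibre

variable {H Γ : Type*} [Group H] [Fintype H] [DecidableEq H] [Group Γ] [Fintype Γ] [DecidableEq Γ]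
variable {K : Type} [Field K] [NumberField K] [IsCMField K] [IsGalois ℚ K]

/-- **TWO-FIBRE TYPES ARE SIMPLE AND DEGENERATE.**  `Gal(K/ℚ) ≅ H × Γ`, `c = (1, c₁)`; `F ⊆ Γ` a primitive CM set
of `(Γ, c₁)`; `A ⊆ H` with `2|A| = |H|`, aperiodic and nowhere self-complementary ⟹ the type "`F` over `A`, `Γ ∖ F`
over `H ∖ A`" gives a SIMPLE DEGENERATE abelian variety of dimension `|H||Γ|/2` with CM by `K`.
[cite: Shimura1998, §6.2 Thm. 3 and §8.2 Prop. 26] [cite: Gordon1999HodgeAVSurvey, Thm. 6.4 and §9.3] -/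
theorem exists_simple_degenerate_of_model_twoFibre (e : (K ≃ₐ[ℚ] K) ≃* H × Γ) (c₁ : Γ)
    (hc : e ((IsCMField.complexConj K).restrictScalars ℚ) = (1, c₁)) (F : Finset Γ)
    (hFcm : ∀ v, v ∈ F ↔ c₁ * v ∉ F) (hFprim : ∀ b : Γ, b ≠ 1 → ∃ v, ¬ (v ∈ F ↔ b * v ∈ F))
    (A : Finset H) (hAcard : 2 * A.card = Fintype.card H)
    (hAprim : ∀ a : H, a ≠ 1 → ∃ q, ¬ (q ∈ A ↔ a * q ∈ A)) (hAcomp : ∀ a : H, ∃ q, (q ∈ A ↔ a * q ∈ A)) :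
    ∃ (Φ : CMType K) (φ₀ : K →+* ℂ) (A : AbelianVariety ℂ) (ι : 𝓞 K →+* End A)
      (θ : K →+* Module.End ℂ (complexBetti A.X 1)),
      IsPrimitive (ℂ ≃+* ℂ) Φ.1 φ₀ ∧ ¬ IsNondegenerate Φ ∧ IsCMTypeRealisation Φ A ι θ ∧ A.IsSimple ∧
      A.dim = Fintype.card H * Fintype.card Γ / 2 ∧
      ∃ n p : ℕ, ∃ x : complexBetti (⨁ fun _ : Fin n => A).X (2 * p), IsRationalClass x ∧
        IsOfHodgeType (⨁ fun _ : Fin n => A).dim (⨁ fun _ : Fin n => A).X (2 * p) p p x ∧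
        x ∉ divisorClassesSpan (⨁ fun _ : Fin n => A).X (⨁ fun _ : Fin n => A).dim p := by
  classical
  have hcc : c₁ * c₁ = 1 := by
    have h := GaloisRank.model_complexConj_mul_self e hc
    rw [Prod.mk_mul_mk, Prod.mk_eq_one] at h
    exact h.2
  have hc1 : c₁ ≠ 1 := fun h1 => GaloisRank.model_complexConj_ne_one e hc (by rw [h1]; rfl)
  -- `F` is nonempty: it contains `1` or `c₁`
  obtain ⟨v₁, hv₁⟩ : ∃ v₁, v₁ ∈ F := by
    by_cases h : (1 : Γ) ∈ F
    · exact ⟨1, h⟩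
    · refine ⟨c₁, ?_⟩
      by_contra h'
      exact h ((hFcm 1).2 (by rwa [mul_one]))
  -- the fibres
  set τ : H → Finset Γ := fun q => if q ∈ A then F else Finset.univ.filter fun v => v ∉ F with hτ_def
  have hτA : ∀ q, q ∈ A → ∀ v, v ∈ τ q ↔ v ∈ F := fun q hq v => by simp [hτ_def, hq]
  have hτB : ∀ q, q ∉ A → ∀ v, v ∈ τ q ↔ v ∉ F := fun q hq v => by simp [hτ_def, hq]
  have hmain := exists_simple_degenerate_of_model_fibres e 1 c₁ hc hc1 τ
    (fun q v => by
      rw [one_mul]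
      by_cases hq : q ∈ A
      · rw [hτA q hq, hτA q hq]; exact hFcm v
      · rw [hτB q hq, hτB q hq, not_not, (hFcm (c₁ * v)), ← mul_assoc, hcc, one_mul])
    (by
      rintro ⟨a, b⟩ hy
      by_contra hcon
      push Not at hcon
      simp only at hcon
      -- `hcon : ∀ q v, v ∈ τ q ↔ b * v ∈ τ (a * q)`
      by_cases hb1 : b = 1
      · subst hb1
        have ha : a ≠ 1 := fun ha => hy (Prod.ext ha rfl)
        obtain ⟨q, hq⟩ := hAprim a ha
        apply hq
        have h1 := hcon q v₁
        rw [one_mul] at h1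
        by_cases hqA : q ∈ A
        · by_cases hqA' : a * q ∈ A
          · exact ⟨fun _ => hqA', fun _ => hqA⟩
          · rw [hτA q hqA, hτB _ hqA'] at h1
            exact absurd (h1.1 hv₁) (not_not.2 hv₁)
        · by_cases hqA' : a * q ∈ A
          · rw [hτB q hqA, hτA _ hqA'] at h1
            exact absurd hv₁ (h1.2 hv₁)
          · exact ⟨fun h => absurd h hqA, fun h => absurd h hqA'⟩
      by_cases hbc : b = c₁
      · subst hbc
        obtain ⟨q, hq⟩ := hAcomp a
        have h1 := hcon q v₁
        have hcv : b * v₁ ∉ F := (hFcm v₁).1 hv₁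
        by_cases hqA : q ∈ A
        · rw [hτA q hqA, hτA _ (hq.1 hqA)] at h1
          exact hcv (h1.1 hv₁)
        · rw [hτB q hqA, hτB _ (fun h => hqA (hq.2 h))] at h1
          exact absurd hv₁ (h1.2 hcv)
      · -- `b ∉ {1, c₁}`: `b` or `c₁ b` would stabilise `F`
        have hcb : c₁ * b ≠ 1 := fun h => hbc (by
          rw [← one_mul b, ← hcc, mul_assoc, h, mul_one])
        by_cases hs : ((1 : H) ∈ A ↔ a * 1 ∈ A)
        · obtain ⟨v, hv⟩ := hFprim b hb1
          apply hv
          have h1 := hcon 1 v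
          by_cases h1A : (1 : H) ∈ A
          · rwa [hτA 1 h1A, hτA _ (hs.1 h1A)] at h1
          · rw [hτB 1 h1A, hτB _ (fun h => h1A (hs.2 h))] at h1
            exact not_iff_not.1 h1
        · obtain ⟨v, hv⟩ := hFprim (c₁ * b) hcb
          apply hv
          have h1 := hcon 1 v
          rw [mul_assoc]
          by_cases h1A : (1 : H) ∈ A
          · have h1A' : a * 1 ∉ A := fun h => hs ⟨fun _ => h, fun _ => h1A⟩
            rw [hτA 1 h1A, hτB _ h1A'] at h1
            rw [h1, (hFcm (b * v)).not, not_not]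
          · have h1A' : a * 1 ∈ A := by
              by_contra h; exact hs ⟨fun h' => absurd h' h1A, fun h' => absurd h' h⟩
            rw [hτB 1 h1A, hτA _ h1A'] at h1
            exact not_not.symm.trans (h1.not.trans ((hFcm (b * v)).not.trans not_not)))
    (fun v => by
      by_cases hv : v ∈ F
      · have : (Finset.univ.filter fun q => v ∈ τ q) = A := by
          ext q
          simp only [Finset.mem_filter, Finset.mem_univ, true_and]
          by_cases hq : q ∈ A
          · rw [hτA q hq]; exact ⟨fun _ => hq, fun _ => hv⟩
          · rw [hτB q hq]; exact ⟨fun h => absurd hv h, fun h => absurd h hq⟩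
        rw [this, hAcard]
      · have : (Finset.univ.filter fun q => v ∈ τ q) = Finset.univ \ A := by
          ext q
          simp only [Finset.mem_filter, Finset.mem_univ, true_and, Finset.mem_sdiff]
          by_cases hq : q ∈ A
          · rw [hτA q hq]; exact ⟨fun h => absurd h hv, fun h => absurd hq h⟩
          · rw [hτB q hq]; exact ⟨fun _ => hq, fun _ => hv⟩
        rw [this, Finset.card_sdiff_of_subset (Finset.subset_univ _), Finset.card_univ]
        omega)
  exact hmain

end TwoFibre

section Quaternion

open QuaternionGroup

variable {H : Type*} [Group H] [Fintype H] [DecidableEq H]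
variable {K : Type} [Field K] [NumberField K] [IsCMField K] [IsGalois ℚ K]

/-- **`Q_{4n}`-CM fields die under every totally real Galois factor with a balanced aperiodic nowhere
self-complementary half.**  `Gal(K/ℚ) ≅ H × Q_{4n}` (`n ≥ 1`), `c = (1, aⁿ)`, `A ⊆ H` with `2|A| = |H|`, aperiodic,
nowhere self-complementary ⟹ a SIMPLE DEGENERATE abelian variety of dimension `2n|H|` with CM by `K` (two-fibre
type over the quaternionic double interval). [cite: Shimura1998, §6.2 Thm. 3 and §8.2 Prop. 26]
[cite: Gordon1999HodgeAVSurvey, Thm. 6.4 and §9.3] -/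
theorem exists_simple_degenerate_of_quaternion_compositum {n : ℕ} (h1 : 1 ≤ n)
    (e : (K ≃ₐ[ℚ] K) ≃* H × QuaternionGroup n)
    (hc : e ((IsCMField.complexConj K).restrictScalars ℚ) = (1, a n))
    (A : Finset H) (hAcard : 2 * A.card = Fintype.card H)
    (hAprim : ∀ x : H, x ≠ 1 → ∃ q, ¬ (q ∈ A ↔ x * q ∈ A)) (hAcomp : ∀ x : H, ∃ q, (q ∈ A ↔ x * q ∈ A)) :
    ∃ (Φ : CMType K) (φ₀ : K →+* ℂ) (A : AbelianVariety ℂ) (ι : 𝓞 K →+* End A)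
      (θ : K →+* Module.End ℂ (complexBetti A.X 1)),
      IsPrimitive (ℂ ≃+* ℂ) Φ.1 φ₀ ∧ ¬ IsNondegenerate Φ ∧ IsCMTypeRealisation Φ A ι θ ∧ A.IsSimple ∧
      A.dim = 2 * n * Fintype.card H ∧
      ∃ n p : ℕ, ∃ x : complexBetti (⨁ fun _ : Fin n => A).X (2 * p), IsRationalClass x ∧
        IsOfHodgeType (⨁ fun _ : Fin n => A).dim (⨁ fun _ : Fin n => A).X (2 * p) p p x ∧
        x ∉ divisorClassesSpan (⨁ fun _ : Fin n => A).X (⨁ fun _ : Fin n => A).dim p := by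
  classical
  haveI : NeZero n := ⟨by omega⟩
  obtain ⟨Ψ₀, hA, hX⟩ := exists_quaternionDoubleInterval (n := n)
  have hmain := exists_simple_degenerate_of_model_twoFibre e (a n) hc Ψ₀ (quaternion_doubleInterval_cm hA hX)
    (quaternion_doubleInterval_leftStabiliser hA hX) A hAcard hAprim hAcomp
  rwa [QuaternionGroup.card, show Fintype.card H * (4 * n) / 2 = 2 * n * Fintype.card H by
    rw [show Fintype.card H * (4 * n) = 2 * n * Fintype.card H * 2 by ring, Nat.mul_div_cancel _ two_pos]]
    at hmain

/-- The half `{0, 1, 3} ⊂ ℤ/6` is balanced, aperiodic and nowhere self-complementary. [folklore] -/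
theorem cyclicSix_half :
    2 * ({Multiplicative.ofAdd (0 : ZMod 6), Multiplicative.ofAdd 1, Multiplicative.ofAdd 3} :
      Finset (Multiplicative (ZMod 6))).card = Fintype.card (Multiplicative (ZMod 6)) ∧
    (∀ x : Multiplicative (ZMod 6), x ≠ 1 → ∃ q, ¬ (q ∈ ({Multiplicative.ofAdd (0 : ZMod 6),
      Multiplicative.ofAdd 1, Multiplicative.ofAdd 3} : Finset (Multiplicative (ZMod 6))) ↔
      x * q ∈ ({Multiplicative.ofAdd (0 : ZMod 6), Multiplicative.ofAdd 1, Multiplicative.ofAdd 3} :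
        Finset (Multiplicative (ZMod 6))))) ∧
    (∀ x : Multiplicative (ZMod 6), ∃ q, (q ∈ ({Multiplicative.ofAdd (0 : ZMod 6), Multiplicative.ofAdd 1,
      Multiplicative.ofAdd 3} : Finset (Multiplicative (ZMod 6))) ↔
      x * q ∈ ({Multiplicative.ofAdd (0 : ZMod 6), Multiplicative.ofAdd 1, Multiplicative.ofAdd 3} :
        Finset (Multiplicative (ZMod 6))))) := by
  refine ⟨by decide, by decide, by decide⟩

/-- **`Gal(K/ℚ) ≅ C₆ × Q_{4n}` (`n ≥ 1`, `c = (0, aⁿ)`) — a real cyclic sextic field times a `Q_{4n}`-CM field: a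
SIMPLE DEGENERATE abelian variety of dimension `12n` with CM by `K`.** [cite: Shimura1998, §6.2 Thm. 3 and §8.2
Prop. 26] [cite: Gordon1999HodgeAVSurvey, Thm. 6.4] -/
theorem exists_simple_degenerate_of_quaternion_cyclicSix_compositum {n : ℕ} (h1 : 1 ≤ n)
    (e : (K ≃ₐ[ℚ] K) ≃* Multiplicative (ZMod 6) × QuaternionGroup n)
    (hc : e ((IsCMField.complexConj K).restrictScalars ℚ) = (1, a n)) :
    ∃ (Φ : CMType K) (φ₀ : K →+* ℂ) (A : AbelianVariety ℂ) (ι : 𝓞 K →+* End A)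
      (θ : K →+* Module.End ℂ (complexBetti A.X 1)),
      IsPrimitive (ℂ ≃+* ℂ) Φ.1 φ₀ ∧ ¬ IsNondegenerate Φ ∧ IsCMTypeRealisation Φ A ι θ ∧ A.IsSimple ∧
      A.dim = 12 * n ∧
      ∃ n p : ℕ, ∃ x : complexBetti (⨁ fun _ : Fin n => A).X (2 * p), IsRationalClass x ∧
        IsOfHodgeType (⨁ fun _ : Fin n => A).dim (⨁ fun _ : Fin n => A).X (2 * p) p p x ∧
        x ∉ divisorClassesSpan (⨁ fun _ : Fin n => A).X (⨁ fun _ : Fin n => A).dim p := by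
  obtain ⟨hcard, hprim, hcomp⟩ := cyclicSix_half
  have hmain := exists_simple_degenerate_of_quaternion_compositum h1 e hc _ hcard hprim hcomp
  rwa [Fintype.card_multiplicative, ZMod.card, show 2 * n * 6 = 12 * n by ring] at hmain

end Quaternion

end Summit.HodgeConjecture.CorCM.GaloisModels
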